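import Literature.AlgebraicGeometry.HodgeTheory.FermatAokiClaimPStandardLeaves
import Literature.AlgebraicGeometry.HodgeTheory.FermatEigenspaceRestriction
import Literature.AlgebraicGeometry.HodgeTheory.FermatAffineChart
import Literature.Geometry.ComplexAnalytic.PhamBrieskornJoinMultiplicity
import Literature.AlgebraicTopology.SingularHomology.UniversalCoefficientsField
import Literature.AlgebraicTopology.SingularHomology.CohomologyHomotopyInvariance
import HarnessLib

/-!
# The character eigenspaces `V(α)`, `α ≠ 0`, of `H²ʳ(X²ʳₘ(ℂ); ℂ)` are at most lines (Ran 1980, Prop. 1.7 (i)) — discharge of `Ran1980_fermatEigenspace_le_span`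

Family `hodge`, layer `Literature/AlgebraicGeometry/HodgeTheory`. PROOF FILE (theorems only: no
definition, no named fact; D-0026) discharging the named fact `Ran1980_fermatEigenspace_le_span` of
`FermatAokiClaimPStandardLeaves` — Z. Ran, *Cycles on Fermat hypersurfaces*, Compositio Math. 42
(1980), §1 Prop. 1.7 (i): "the character decomposition of `Pₙ(Vⁿₘ)` is `⊕ {H_χ : χ relevant}` with
each `H_χ` 1-dimensional"; N. Aoki, J. Math. Soc. Japan 39 (1987), p. 385: "It is well known that
`dim V(α) = 1` for `α ∈ 𝔄ⁿₘ`"; T. Shioda, Math. Ann. 245 (1979), §1 — in the form the tree consumes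
(`dim V(α) ≤ 1` for `α` admissible, `V(α) ⊆ H²ʳ(X²ʳₘ(ℂ); ℂ)`, `r > 0`; hypothesis `hE1` of
`Aoki1987_claim_pStandard_of_subvariety_represents`, `ShiodaClaimPairedProofs`,
`FermatLinearSubspaceClass`, `FermatJuxtapositionGysin`).

The proof is the printed one (Ran §1 before Prop. 1.7 with Lemma 1.4; Pham 1965 §1 / Milnor 1968
§9 for the affine Fermat variety), assembled from bricks the tree already proves:

* `restrictCompl_injOn_fermatEigenspace_middle` (`FermatEigenspaceRestriction`): for `α ≠ 0`
  restriction `H²ʳ(X²ʳₘ(ℂ)) → H²ʳ(U_k(ℂ))`, `U_k = X ∖ {x_k = 0}`, is injective on `V(α)`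
  (Thom–Gysin for the coordinate section and weak Lefschetz: the kernel is the line of ambient
  classes, on which `μₘ²ʳ⁺²` acts trivially);
* `fermatFibreHomeomorph` (`FermatAffineChart`): `U_k(ℂ) ≃ₜ {Σ zⱼᵐ = 1}`, the Milnor fibre of the
  Pham–Brieskorn polynomial in `2r + 1` variables, in which the symmetry `g_a`,
  `a = (u₀, …, 1, …, u_{2r})` (`1` in slot `k`) is the coordinatewise rotation by `u`
  (`fermatFibreHomeomorph_diagonalMapCompl_insertNth`, from
  `fermatAffineChartFun_diagonalMapCompl`);
* `PhamBrieskorn.joinHomotopyEquivFibre` (`PhamBrieskornJoin`): the join `J = μₘ * ⋯ * μₘ` is an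
  (equivariant) deformation retract of the fibre, so the lift `e = φ⁻¹ ∘ incl : J → U_k(ℂ)`
  (`exists_joinMap`) is injective on cohomology and equivariant (`map_joinMap_injective`,
  `diagonalMap_comp_joinMap`);
* `PhamBrieskorn.exists_covariants_le_span` (`PhamBrieskornJoinMultiplicity`): every character of
  the torus `μₘ²ʳ⁺¹` occurs at most once in `H₂ᵣ(J; ℂ)` (Milnor Thm. 9.1: `H̃₂ᵣ(J) = ⊗ H̃₀(μₘ)`), in
  the dual form "the `θ`-covariant functionals lie on a line";
* universal coefficients over a field (`kroneckerPairing_injective_of_field`,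
  `kroneckerPairing_map`): `v ↦ ⟨(φ⁻¹ ∘ incl)^* v|_{U_k}, -⟩` embeds `V(α)` into the
  `θ`-covariant functionals,
  `θ(u) = χ_α(u₀, …, 1, …, u_{2r})` (`kroneckerPairing_map_mem_covariants`,
  `exists_le_span_of_equivariant`), and a space injecting linearly into a line is a line
  (`PhamBrieskorn.exists_le_span_of_injOn`).

Main statements: `fermatEigenspace_le_span_of_ne_zero` (`dim V(α) ≤ 1` in `H²ʳ(X²ʳₘ(ℂ); ℂ)` for
every `α ≠ 0`, `r, m ≥ 1`) and `Ran1980_fermatEigenspace_le_span_holds`. The equality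
`dim V(α) = 1` for admissible `α` (existence of a non-zero eigenclass) is NOT proved here and is
not needed downstream.

## References

* [Ran1980] Z. Ran, Cycles on Fermat hypersurfaces, Compositio Math. 42 (1980) 121–142, §1
  Lemma 1.4, (1.5), Prop. 1.7 (i).
* [Aoki1987] N. Aoki, Some new algebraic cycles on Fermat varieties, J. Math. Soc. Japan 39 (1987)
  385–396, p. 385.
* [Shioda1979HodgeFermat] T. Shioda, The Hodge conjecture for Fermat varieties, Math. Ann. 245
  (1979) 175–184, §1 (cite-only).
* [Milnor1968] J. Milnor, Singular Points of Complex Hypersurfaces, Ann. of Math. Studies 61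
  (1968), §9 Thm. 9.1, Lemma 9.2, p. 77.
* [Pham1965] F. Pham, Formules de Picard–Lefschetz généralisées et ramification des intégrales,
  Bull. Soc. Math. France 93 (1965) 333–367, §1.
* [HatcherAT2002] A. Hatcher, Algebraic Topology, CUP 2002, §3.1 Thm. 3.2 (universal
  coefficients over a field), p. 201 (homotopy invariance).
-/

noncomputable section

open CategoryTheory AlgebraicGeometry

namespace Literature.AlgebraicGeometry.HodgeTheory

open Literature.AlgebraicGeometry.Motives Literature.AlgebraicTopology.SingularHomology
open Literature.Geometry.ComplexAnalytic Literature.Geometry.ComplexAnalytic.PhamBrieskorn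

/-! ### Equivariant maps from the join: covariant functionals and the line bound -/

section Join

variable {N : ℕ} {a : Fin (N + 1) → ℕ} {T : Type} [TopologicalSpace T]

/-- **Kronecker duals of eigenclasses are covariant functionals.** Let `e : J → T` (`J` the join
`Ω_{a₀} * ⋯ * Ω_{a_N}`) intertwine the coordinatewise action `act u` of the torus with self-maps
`ρ_u` of `T` (`ρ_u ∘ e = e ∘ act u`), and let `y ∈ Hᵇ(T; ℂ)` satisfy `ρ_u^* y = θ(u) y` for all `u`.
Then the functional `⟨e^* y, -⟩` on `H_b(J; ℂ)` is `θ`-covariant: `⟨e^* y, (act u)_* x⟩ =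
⟨(act u)^* e^* y, x⟩ = ⟨e^* ρ_u^* y, x⟩ = θ(u) ⟨e^* y, x⟩` (naturality of the Kronecker pairing).
[cite: Milnor1968, §9 Thm. 9.1 and p. 77] [cite: HatcherAT2002, §3.1 Thm. 3.2] -/
theorem kroneckerPairing_map_mem_covariants (e : C(join a, T)) (b : ℕ) (ρ : Torus a → C(T, T))
    (hρ : ∀ u, (ρ u).comp e = e.comp (act a u : C(join a, join a))) (θ : Torus a → ℂ)
    (y : singularCohomology ℂ ℂ T b) (hy : ∀ u, singularCohomology.map ℂ ℂ (ρ u) b y = θ u • y) :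
    kroneckerPairing ℂ ℂ (join a) b (singularCohomology.map ℂ ℂ e b y) ∈
      covariants (actRep a b) θ := by
  rw [mem_covariants_iff]
  intro u
  refine LinearMap.ext fun x ↦ ?_
  rw [LinearMap.comp_apply, LinearMap.smul_apply]
  change kroneckerPairing ℂ ℂ (join a) b (singularCohomology.map ℂ ℂ e b y)
      (singularHomology.map ℂ ℂ (act a u : C(join a, join a)) b x) = _
  rw [← kroneckerPairing_map, ← ModuleCat.comp_apply, ← singularCohomology.map_comp, ← hρ u,
    singularCohomology.map_comp, ModuleCat.comp_apply, hy u, map_smul, map_smul,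
    LinearMap.smul_apply, smul_eq_mul]

/-- **The line bound, abstract form.** Let `e : J → T` intertwine the torus action on the join
`J = Ω_{a₀} * ⋯ * Ω_{a_N}` (all `aⱼ ≠ 0`) with self-maps `ρ_u` of `T`, and let `S ⊆ Hᴺ(T; ℂ)` be a
subspace on which `e^*` is injective and on which every `ρ_u^*` acts by the scalar `θ(u)` for a
character `θ` of the torus. Then `S` is at most a line: `v ↦ ⟨e^* v, -⟩` embeds `S` (Kronecker
injectivity over a field) into the `θ`-covariant functionals on `H_N(J; ℂ)`, which lie on a line
(`PhamBrieskorn.exists_covariants_le_span`: every character of the torus occurs at most once in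
`H_N(J; ℂ)`, Milnor Thm. 9.1 / Pham), and a space injecting linearly into a line is a line
(`PhamBrieskorn.exists_le_span_of_injOn`). [cite: Milnor1968, §9 Thm. 9.1 and p. 77]
[cite: Pham1965, §1] [cite: HatcherAT2002, §3.1 Thm. 3.2] -/
theorem exists_le_span_of_equivariant (ha : ∀ i, a i ≠ 0) (e : C(join a, T))
    (S : Submodule ℂ (singularCohomology ℂ ℂ T N))
    (he : ∀ v ∈ S, singularCohomology.map ℂ ℂ e N v = 0 → v = 0) (ρ : Torus a → C(T, T))
    (hρ : ∀ u, (ρ u).comp e = e.comp (act a u : C(join a, join a))) (θ : Torus a →* ℂˣ)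
    (hS : ∀ v ∈ S, ∀ u, singularCohomology.map ℂ ℂ (ρ u) N v = ((θ u : ℂˣ) : ℂ) • v) :
    ∃ v₀, S ≤ ℂ ∙ v₀ := by
  obtain ⟨f₀, hf₀⟩ := exists_covariants_le_span ha θ
  refine exists_le_span_of_injOn S
    ((kroneckerPairing ℂ ℂ (join a) N).comp (singularCohomology.map ℂ ℂ e N).hom) ?_ f₀ ?_
  · intro v hv h0
    refine he v hv (kroneckerPairing_injective_of_field ℂ (join a) N ?_)
    rw [map_zero]
    exact h0
  · intro v hv
    exact hf₀ (kroneckerPairing_map_mem_covariants e N ρ hρ (fun u ↦ ((θ u : ℂˣ) : ℂ)) v (hS v hv))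

end Join

/-! ### The Fermat variety: the join maps equivariantly into `U_k(ℂ) ⊂ Xⁿₘ(ℂ)` -/

section Fermat

variable {n m : ℕ}

/-- **In the chart `U_k(ℂ) ≃ₜ {Σ zⱼᵐ = 1}` the symmetry `g_a`, `a = (u₀, …, 1, …, uₙ)` (`1` in the
homogeneous slot `k`, `uⱼ` in the slot `k.succAbove j`), is the coordinatewise rotation
`z ↦ (uⱼ zⱼ)ⱼ`** of the Milnor fibre (`g_a` acts in the affine coordinates by the factor
`(a_{k.succAbove j}/a_k)ⱼ = (uⱼ)ⱼ`, `fermatAffineChartFun_diagonalMapCompl`).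
[cite: Ran1980, §1 Lemma 1.4] -/
theorem fermatFibreHomeomorph_diagonalMapCompl_insertNth (hm : m ≠ 0) (k : Fin (n + 2))
    (u : Fin (n + 1) → rootsOfUnity m ℂ)
    (P : complexPointsCompl (fermatHypersurface n m) (fermatCoordHyperplane n m k)) :
    (fermatFibreHomeomorph hm k (diagonalMapCompl k (fermatGroupEquiv m (Fin.insertNth k 1 u)) P) :
        Fin (n + 1) → ℂ) =
      (fun j ↦ ((u j : ℂˣ) : ℂ)) * (fermatFibreHomeomorph hm k P : Fin (n + 1) → ℂ) := by
  rw [fermatFibreHomeomorph_apply_coe, fermatFibreHomeomorph_apply_coe,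
    fermatAffineChartFun_diagonalMapCompl, mul_smul_comm]
  congr 1
  funext j
  simp [chartFactor]

/-- **The character `u ↦ χ_α(u₀, …, 1, …, uₙ)` of the torus `μₘⁿ⁺¹`** (the restriction of `χ_α`
along the section `u ↦ (u₀, …, 1, …, uₙ)`, `1` in slot `k`, of `μₘⁿ⁺² → μₘⁿ⁺²/(k-th factor)`), as
a group homomorphism. [cite: Ran1980, §1 Prop. 1.7 (i)] -/
theorem exists_torusCharacter_eq (k : Fin (n + 2)) (α : Fin (n + 2) → ZMod m) :
    ∃ θ : Torus (fun _ : Fin (n + 1) ↦ m) →* ℂˣ,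
      ∀ u, θ u = fermatCharacter m α (fermatGroupEquiv m (Fin.insertNth k 1 u)) := by
  refine ⟨MonoidHom.mk' (fun u ↦ fermatCharacter m α (fermatGroupEquiv m (Fin.insertNth k 1 u)))
    fun u w ↦ ?_, fun u ↦ rfl⟩
  have h : (Fin.insertNth k (1 : rootsOfUnity m ℂ) (u * w) : Fin (n + 2) → rootsOfUnity m ℂ) =
      Fin.insertNth k 1 u * Fin.insertNth k 1 w := by
    rw [← Fin.insertNth_mul, mul_one]
  simp only [h, map_mul]

/-- **The lift `e = φ⁻¹ ∘ incl : J → U_k(ℂ)` of the join exists**: `φ : U_k(ℂ) ≃ₜ {Σ zⱼᵐ = 1}` the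
Pham–Brieskorn chart (`fermatFibreHomeomorph`), `incl : J ↪ {Σ zⱼᵐ = 1}` the inclusion of the join
`J = μₘ * ⋯ * μₘ`; it is characterised by `φ ∘ e = incl`. [cite: Milnor1968, §9 p. 76] -/
theorem exists_joinMap (hm : m ≠ 0) (k : Fin (n + 2)) :
    ∃ e : C(join (fun _ : Fin (n + 1) ↦ m),
        complexPointsCompl (fermatHypersurface n m) (fermatCoordHyperplane n m k)),
      ∀ z, (fermatFibreHomeomorph hm k (e z) : Fin (n + 1) → ℂ) = z :=
  ⟨((fermatFibreHomeomorph hm k).symm : C(fibre (fun _ : Fin (n + 1) ↦ m),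
      complexPointsCompl (fermatHypersurface n m) (fermatCoordHyperplane n m k))).comp
      ⟨Set.inclusion join_subset_fibre, continuous_inclusion join_subset_fibre⟩,
    fun z ↦ by
      rw [ContinuousMap.comp_apply, ContinuousMap.coe_coe, Homeomorph.apply_symm_apply]
      rfl⟩

/-- A lift `e` with `φ ∘ e = incl` IS `φ⁻¹ ∘ incl`. [cite: Milnor1968, §9 p. 76] -/
theorem joinMap_eq (hm : m ≠ 0) (k : Fin (n + 2))
    {e : C(join (fun _ : Fin (n + 1) ↦ m),
      complexPointsCompl (fermatHypersurface n m) (fermatCoordHyperplane n m k))}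
    (he : ∀ z, (fermatFibreHomeomorph hm k (e z) : Fin (n + 1) → ℂ) = z) :
    e = ((fermatFibreHomeomorph hm k).symm : C(fibre (fun _ : Fin (n + 1) ↦ m),
      complexPointsCompl (fermatHypersurface n m) (fermatCoordHyperplane n m k))).comp
      ⟨Set.inclusion join_subset_fibre, continuous_inclusion join_subset_fibre⟩ := by
  refine ContinuousMap.ext fun z ↦ (fermatFibreHomeomorph hm k).injective (Subtype.ext ?_)
  rw [he, ContinuousMap.comp_apply, ContinuousMap.coe_coe, Homeomorph.apply_symm_apply]
  rfl

/-- **`e^* : Hᵇ(U_k(ℂ); ℂ) → Hᵇ(J; ℂ)` is injective** for the lift `e = φ⁻¹ ∘ incl` of the join: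
`φ` is a homeomorphism and `incl : J ↪ {Σ zⱼᵐ = 1}` a homotopy equivalence (Pham's Lemma,
`joinHomotopyEquivFibre`). [cite: Milnor1968, §9 Lemma 9.2] [cite: Pham1965, §1] -/
theorem map_joinMap_injective (hm : m ≠ 0) (k : Fin (n + 2))
    {e : C(join (fun _ : Fin (n + 1) ↦ m),
      complexPointsCompl (fermatHypersurface n m) (fermatCoordHyperplane n m k))}
    (he : ∀ z, (fermatFibreHomeomorph hm k (e z) : Fin (n + 1) → ℂ) = z) (b : ℕ) :
    Function.Injective (singularCohomology.map ℂ ℂ e b) := by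
  have ha : ∀ i : Fin (n + 1), (fun _ : Fin (n + 1) ↦ m) i ≠ 0 := fun _ ↦ hm
  have hincl : Function.Injective (singularCohomology.map ℂ ℂ
      (⟨Set.inclusion join_subset_fibre, continuous_inclusion join_subset_fibre⟩ :
        C(join (fun _ : Fin (n + 1) ↦ m), fibre (fun _ : Fin (n + 1) ↦ m))) b) := by
    have h := ConcreteCategory.bijective_of_isIso (singularCohomology.isoOfHomotopyEquiv' ℂ ℂ
      (joinHomotopyEquivFibre (fun _ : Fin (n + 1) ↦ m) ha) b).hom
    rw [singularCohomology.isoOfHomotopyEquiv'_hom, joinHomotopyEquivFibre_toFun] at h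
    exact h.1
  have hφ : Function.Injective (singularCohomology.map ℂ ℂ
      ((fermatFibreHomeomorph hm k).symm : C(fibre (fun _ : Fin (n + 1) ↦ m),
        complexPointsCompl (fermatHypersurface n m) (fermatCoordHyperplane n m k))) b) := by
    intro y y' h
    have h2 := congrArg (singularCohomology.map ℂ ℂ (fermatFibreHomeomorph hm k :
      C(complexPointsCompl (fermatHypersurface n m) (fermatCoordHyperplane n m k),
        fibre (fun _ : Fin (n + 1) ↦ m))) b) h
    rwa [← ModuleCat.comp_apply, ← ModuleCat.comp_apply, ← singularCohomology.map_comp,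
      Homeomorph.symm_comp_toContinuousMap, singularCohomology.map_id] at h2
  intro y y' h
  rw [joinMap_eq hm k he, singularCohomology.map_comp, ModuleCat.comp_apply,
    ModuleCat.comp_apply] at h
  exact hφ (hincl h)

/-- **The composite `J → U_k(ℂ) ↪ Xⁿₘ(ℂ)` intertwines the coordinatewise action of the torus
`μₘⁿ⁺¹` on the join with the diagonal symmetries `g_a`, `a = (u₀, …, 1, …, uₙ)`, of the Fermat
variety** (`fermatFibreHomeomorph_diagonalMapCompl_insertNth` on points).
[cite: Ran1980, §1 Lemma 1.4] [cite: Milnor1968, §9 p. 77] -/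
theorem diagonalMap_comp_joinMap (hm : m ≠ 0) (k : Fin (n + 2))
    {e : C(join (fun _ : Fin (n + 1) ↦ m),
      complexPointsCompl (fermatHypersurface n m) (fermatCoordHyperplane n m k))}
    (he : ∀ z, (fermatFibreHomeomorph hm k (e z) : Fin (n + 1) → ℂ) = z)
    (u : Torus (fun _ : Fin (n + 1) ↦ m)) :
    (diagonalMap (fermatPolynomial ℂ n m)
        (fermatGroup_le_diagonalStabilizer m (fermatGroupEquiv m (Fin.insertNth k 1 u)).2)).comp
      ((⟨Subtype.val, continuous_subtype_val⟩ :
        C(complexPointsCompl (fermatHypersurface n m) (fermatCoordHyperplane n m k),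
          ComplexPoints (fermatHypersurface n m))).comp e) =
      ((⟨Subtype.val, continuous_subtype_val⟩ :
        C(complexPointsCompl (fermatHypersurface n m) (fermatCoordHyperplane n m k),
          ComplexPoints (fermatHypersurface n m))).comp e).comp
        (act (fun _ : Fin (n + 1) ↦ m) u :
          C(join (fun _ : Fin (n + 1) ↦ m), join (fun _ : Fin (n + 1) ↦ m))) := by
  refine ContinuousMap.ext fun z ↦ ?_
  change ((diagonalMapCompl k (fermatGroupEquiv m (Fin.insertNth k 1 u)) (e z)) :
      ComplexPoints (fermatHypersurface n m)) =
    ((e (act (fun _ : Fin (n + 1) ↦ m) u z)) : ComplexPoints (fermatHypersurface n m))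
  congr 1
  apply (fermatFibreHomeomorph hm k).injective
  refine Subtype.ext ?_
  rw [fermatFibreHomeomorph_diagonalMapCompl_insertNth, he, he]
  rfl

/-- **`dim V(α) ≤ 1` for every character `α ≠ 0` in the middle cohomology `H²ʳ(X²ʳₘ(ℂ); ℂ)` of
the even-dimensional Fermat variety** (`r ≥ 1`, `m ≥ 1`, read on any affine piece `U_k`):
restriction to `U_k(ℂ)` is injective on `V(α)` (`restrictCompl_injOn_fermatEigenspace_middle`,
Ran (1.5) / Lemma 1.4), `U_k(ℂ)` is the Milnor fibre `{Σ zⱼᵐ = 1}` retracting equivariantly onto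
the join `μₘ * ⋯ * μₘ` (`2r + 1` factors), along which `V(α)` is carried into the eigenclasses of
the character `u ↦ χ_α(u₀, …, 1, …, u_{2r})` of the torus `μₘ²ʳ⁺¹`, and every character of the
torus occurs at most once in `H₂ᵣ(J; ℂ)` (Pham; Milnor Thm. 9.1; `exists_le_span_of_equivariant`).
This is Ran's Prop. 1.7 (i) "each `H_χ` is 1-dimensional" in the form `≤ 1` (which also covers
the non-admissible `α ≠ 0`, whose `V(α) ∩ H²ʳ` vanishes). [cite: Ran1980, §1 Prop. 1.7 (i)]
[cite: Milnor1968, §9 Thm. 9.1] [cite: Aoki1987, p. 385 (dim V(α) = 1)] -/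
theorem fermatEigenspace_le_span_of_ne_zero (hm : m ≠ 0) {r : ℕ} (hr : 1 ≤ r)
    (k : Fin (2 * r + 2)) {α : Fin (2 * r + 2) → ZMod m} (hα : α ≠ 0) :
    ∃ v, fermatEigenspace m α (2 * r) ≤ ℂ ∙ v := by
  have ha : ∀ i : Fin (2 * r + 1), (fun _ : Fin (2 * r + 1) ↦ m) i ≠ 0 := fun _ ↦ hm
  obtain ⟨θ, hθ⟩ := exists_torusCharacter_eq (n := 2 * r) k α
  obtain ⟨e, he⟩ := exists_joinMap (n := 2 * r) hm k
  refine exists_le_span_of_equivariant (T := ComplexPoints (fermatHypersurface (2 * r) m)) ha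
    ((⟨Subtype.val, continuous_subtype_val⟩ :
      C(complexPointsCompl (fermatHypersurface (2 * r) m) (fermatCoordHyperplane (2 * r) m k),
        ComplexPoints (fermatHypersurface (2 * r) m))).comp e)
    (fermatEigenspace m α (2 * r)) ?_
    (fun u ↦ diagonalMap (fermatPolynomial ℂ (2 * r) m)
      (fermatGroup_le_diagonalStabilizer m (fermatGroupEquiv m (Fin.insertNth k 1 u)).2))
    (fun u ↦ diagonalMap_comp_joinMap hm k he u) θ ?_
  · -- `e^* ∘ res` is injective on `V(α)`
    intro v hv h0
    rw [singularCohomology.map_comp, ModuleCat.comp_apply] at h0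
    have h1 : complexBetti.restrictCompl (fermatHypersurface (2 * r) m)
        (fermatCoordHyperplane (2 * r) m k) (2 * r) v = 0 := by
      apply map_joinMap_injective hm k he (2 * r)
      rw [map_zero]
      exact h0
    refine restrictCompl_injOn_fermatEigenspace_middle (Nat.one_le_iff_ne_zero.mpr hm) hr k hα hv
      (zero_mem _) ?_
    rw [map_zero]
    exact h1
  · -- `g_a^* v = χ_α(a) v` on `V(α)`
    intro v hv u
    rw [hθ u]
    exact (mem_fermatEigenspace_iff.mp hv) _

end Fermat

/-! ### The discharge -/

/-- **The eigenspaces `V(α)`, `α ∈ 𝔄²ʳₘ`, of `H²ʳ(X²ʳₘ(ℂ); ℂ)` are at most lines — discharge of the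
named fact `Ran1980_fermatEigenspace_le_span`** (Ran 1980, §1 Prop. 1.7 (i): the character
decomposition of the primitive cohomology of the Fermat variety under `μₘⁿ⁺²/Δ` has multiplicity
one; Aoki 1987, p. 385 "it is well known that `dim V(α) = 1`"; Shioda 1979, §1). Proof: an
admissible character is non-zero, and `fermatEigenspace_le_span_of_ne_zero` (restriction to the
affine piece `U₀(ℂ)`, injective on `V(α)` by the Thom–Gysin sequence of the coordinate section
and weak Lefschetz; `U₀(ℂ) ≅ {Σ zⱼᵐ = 1} ≃ μₘ * ⋯ * μₘ` equivariantly, Pham; multiplicity one of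
the torus characters in the homology of the join, Milnor Thm. 9.1; universal coefficients over
`ℂ`). Relies on: nothing unproved. [cite: Ran1980, §1 Prop. 1.7 (i)]
[cite: Aoki1987, p. 385 (dim V(α) = 1)] [cite: Milnor1968, §9 Thm. 9.1 and Lemma 9.2] -/
theorem Ran1980_fermatEigenspace_le_span_holds : Ran1980_fermatEigenspace_le_span := by
  intro m r _ α hr hα
  have hα0 : α ≠ 0 := fun h ↦ hα.1 0 (by rw [h]; rfl)
  exact fermatEigenspace_le_span_of_ne_zero (NeZero.ne m) hr 0 hα0

end Literature.AlgebraicGeometry.HodgeTheory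

end
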